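import Literature.NumberTheory.Connes2026.DualCutoffSincKernel
import Literature.NumberTheory.Connes2026.AnnulusScalingSupport
import Literature.Analysis.SpecialFunctions.MellinSin
import HarnessLib

/-!
# The sinc kernel in closed form, `κ(v) = sin(2πv)/(πv)`, the bound `|M κ(Mv)| ≤ 1/(π|v|)` uniform in `M`,
# and the kernel of the separated operator `(1 − Q̃) P̂⁰_M Q`

LABEL (line 1): RH-FREE literature (theorems only; NO definition, NO named fact).  bears_on: LADDER-RH
W-C/W-P (C1 named-fact debt), cell `rh-crit`, sub-cell cc, overflow row O1 — inputs of the separated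
remainder estimate (S1,S0,S2) of the "annulus road" under `Connes1999_thm_VII_4_rat`.  WHAT THIS IS NOT: any
claim about positivity, Weil's criterion or RH.

Sources.  A. Connes, C. Consani (2021) [`ConnesConsani2021`], §4 p. 16 eq. (prolateeq) (the sinc kernel);
A. Connes, Selecta Math. 5 (1999) [`Connes1999`], §VII eq. (13) and proof of Thm 4 (29)–(33).

## What is proved

* **`sincKernel_eq_specialFunctionsSincKernel`** — Connes–Consani's `κ(v) = ∫_{−1}^{1} e^{2πiξv} dξ` IS the tree's
  `Literature.Analysis.SpecialFunctions.sincKernel` (`= sin(2πv)/(πv)`, `= 2` at `0`);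
* `norm_ccSincKernel_le_inv` — `|κ(v)| ≤ 1/(π|v|)`; **`norm_dilatedSinc_le`** — `|M κ(Mv)| ≤ 1/(π|v|)` for `M > 0`
  (the bound behind the UNIFORM Hilbert–Schmidt estimate of the separated kernel);
* **`separatedSinc_coeFn`** — `((1 − Q_{c,d}) P̂⁰_M Q_{a,b} φ)(x) = ∫ 1_{x∉Q_{c,d}} M κ(M(x−y)) 1_{y∈Q_{a,b}} φ(y) dy` a.e.

No instance, notation or attribute; no `def`.
-/

noncomputable section

open _root_.MeasureTheory Complex Set Filter
open scoped Real Topology ComplexConjugate InnerProductSpace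

namespace Literature.NumberTheory.Connes2026

open Literature.NumberTheory.LFunctions Literature.Analysis.OperatorTheory
open Literature.NumberTheory.ConnesConsani
open Literature.NumberTheory.ConnesConsani2024
open Literature.NumberTheory.ConnesConsani2021 hiding cutoffProj cutoffProj_coeFn

/-! ## §1. The sinc kernel in closed form: Connes–Consani's `κ` IS the tree's `Literature.Analysis.SpecialFunctions.sincKernel` -/

/-- **`κ(v) = ∫_{−1}^{1} e^{2πiξv} dξ = sin(2πv)/(πv) = Literature.Analysis.SpecialFunctions.sincKernel v`** (both
equal `2` at `v = 0`): the two sinc kernels of the tree coincide. [cite: ConnesConsani2021, §4 p. 16 eq. (prolateeq) (arXiv p0016:L13–L34)] -/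
theorem sincKernel_eq_specialFunctionsSincKernel (v : ℝ) :
    sincKernel v = Literature.Analysis.SpecialFunctions.sincKernel v := by
  by_cases hv : v = 0
  · rw [hv, Literature.Analysis.SpecialFunctions.sincKernel_zero]
    unfold sincKernel
    simp only [Complex.ofReal_zero, mul_zero, Complex.exp_zero, intervalIntegral.integral_const]
    norm_num
  rw [Literature.Analysis.SpecialFunctions.sincKernel_eq hv]
  unfold sincKernel
  have hπ : (π : ℂ) ≠ 0 := by exact_mod_cast Real.pi_ne_zero
  have hv' : (v : ℂ) ≠ 0 := by exact_mod_cast hv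
  have hI : (I : ℂ) ≠ 0 := Complex.I_ne_zero
  have hc : (2 * π * I * v : ℂ) ≠ 0 := by simp [hπ, hv', hI]
  have h1 : (fun ξ : ℝ => cexp (2 * π * I * ξ * v)) = fun ξ : ℝ => cexp ((2 * π * I * v) * ξ) := by
    funext ξ; ring_nf
  rw [h1, integral_exp_mul_complex hc]
  -- `(e^{2πiv} − e^{−2πiv}) / (2πiv) = 2i sin(2πv)/(2πiv) = sin(2πv)/(πv)`
  have h2 : cexp (2 * π * I * v * (1 : ℝ)) - cexp (2 * π * I * v * (-1 : ℝ)) =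
      2 * I * Complex.sin (2 * π * v) := by
    rw [Complex.sin, Complex.ofReal_one, mul_one, Complex.ofReal_neg, Complex.ofReal_one, mul_neg, mul_one]
    have hI2 : I * I = -1 := Complex.I_mul_I
    rw [show -(2 * π * I * (v : ℂ)) = -(2 * π * v) * I by ring, show 2 * π * I * (v : ℂ) = 2 * π * v * I by ring]
    linear_combination (Complex.exp (2 * ↑π * ↑v * I) - Complex.exp (-(2 * ↑π * ↑v) * I)) * hI2
  rw [h2]
  push_cast
  field_simp

/-- **`|M κ(Mv)| ≤ 1/(π|v|)`** for `M > 0`, `v ≠ 0` — uniform in `M`. [cite: ConnesConsani2021, §4 p. 16 eq. (prolateeq); Connes1999, §VII eq. (13)] -/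
theorem norm_dilatedSinc_le {M v : ℝ} (hM : 0 < M) (hv : v ≠ 0) :
    ‖(M : ℂ) * sincKernel (M * v)‖ ≤ 1 / (π * |v|) := by
  have hMv : M * v ≠ 0 := mul_ne_zero hM.ne' hv
  rw [norm_mul, Complex.norm_real, Real.norm_eq_abs, abs_of_pos hM]
  rw [sincKernel_eq_specialFunctionsSincKernel]
  calc M * ‖Literature.Analysis.SpecialFunctions.sincKernel (M * v)‖ ≤ M * (1 / (π * |M * v|)) :=
        mul_le_mul_of_nonneg_left (Literature.Analysis.SpecialFunctions.norm_sincKernel_le_inv hMv) hM.le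
    _ = 1 / (π * |v|) := by
        rw [abs_mul, abs_of_pos hM]
        field_simp

/-- The dilated sinc kernel is bounded by `2M`. [cite: ConnesConsani2021, §4 p. 16 eq. (prolateeq)] -/
theorem norm_dilatedSinc_le_two_mul {M : ℝ} (hM : 0 < M) (v : ℝ) : ‖(M : ℂ) * sincKernel (M * v)‖ ≤ 2 * M := by
  rw [norm_mul, Complex.norm_real, Real.norm_eq_abs, abs_of_pos hM, mul_comm]
  exact mul_le_mul_of_nonneg_right (norm_sincKernel_le _) hM.le

/-! ## §2. The kernel of the separated operator `(1 − Q̃) P̂⁰_M Q` -/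

/-- **`((1 − Q_{c,d}) P̂⁰_M Q_{a,b} φ)(x) = 1_{x ∉ Q_{c,d}} ∫ M κ(M(x − y)) 1_{Q_{a,b}}(y) φ(y) dy`** a.e. (`M > 0`,
`a ≤ b`, `c ≤ d`). [cite: Connes1999, §VII eq. (13) and proof of Thm 4 eqs. (29)–(33) (arXiv p0013); ConnesConsani2021, §4 p. 15 eq. (complementproj)] -/
theorem separatedSinc_coeFn {M a b c d : ℝ} (hM : 0 < M) (hab : a ≤ b) (hcd : c ≤ d)
    (φ : Lp ℂ 2 (volume : Measure ℝ)) :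
    ((((1 : Lp ℂ 2 (volume : Measure ℝ) →L[ℂ] Lp ℂ 2 (volume : Measure ℝ)) - shellProj c d) ∘L
        (dualCutoffProj ∅ M ∘L shellProj a b)) φ : ℝ → ℂ) =ᵐ[volume] fun x =>
      ∫ y, ((shellSet c d)ᶜ.indicator (fun _ => (1 : ℂ)) x * ((M : ℂ) * sincKernel (M * (x - y))) *
        (shellSet a b).indicator (fun _ => (1 : ℂ)) y) * φ y := by
  rw [ContinuousLinearMap.comp_apply, ContinuousLinearMap.comp_apply, sub_apply]
  set ψ := shellProj a b φ with hψ
  set ξ := dualCutoffProj ∅ M ψ with hξ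
  change (((ξ - shellProj c d ξ : Lp ℂ 2 (volume : Measure ℝ))) : ℝ → ℂ) =ᵐ[volume] _
  have h1 := shellProj_coeFn hcd ξ
  have h2 := dualCutoffProj_empty_coeFn hM ψ
  have h3 := shellProj_coeFn hab φ
  filter_upwards [Lp.coeFn_sub ξ (shellProj c d ξ), h1, h2] with x hsub hx1 hx2
  rw [hsub, Pi.sub_apply, hx1]
  have h4 : ∫ y, (M : ℂ) * sincKernel (M * (x - y)) * (ψ : ℝ → ℂ) y =
      ∫ y, (M : ℂ) * sincKernel (M * (x - y)) * (shellSet a b).indicator (fun _ => (1 : ℂ)) y * φ y := by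
    refine integral_congr_ae ?_
    filter_upwards [h3] with y hy
    rw [hy]
    by_cases hy' : y ∈ shellSet a b
    · rw [Set.indicator_of_mem hy', Set.indicator_of_mem hy', mul_one]
    · rw [Set.indicator_of_notMem hy', Set.indicator_of_notMem hy', mul_zero, zero_mul]
  by_cases hx : x ∈ shellSet c d
  · rw [Set.indicator_of_mem hx, sub_self]
    have h0 : (shellSet c d)ᶜ.indicator (fun _ => (1 : ℂ)) x = 0 :=
      Set.indicator_of_notMem (Set.notMem_compl_iff.mpr hx) _
    simp only [h0, zero_mul, integral_zero]
  · rw [Set.indicator_of_notMem hx, sub_zero]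
    have h0 : (shellSet c d)ᶜ.indicator (fun _ => (1 : ℂ)) x = 1 := Set.indicator_of_mem (Set.mem_compl hx) _
    simp only [h0, one_mul]
    rw [hξ]
    exact hx2.trans h4

end Literature.NumberTheory.Connes2026
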